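import Literature.AlgebraicGeometry.Resolution.BlowupStalkQuadraticTransform
import Literature.AlgebraicGeometry.Resolution.QuadraticTransformsStructure
import Literature.AlgebraicGeometry.Resolution.QuadraticTransformsChart
import Literature.AlgebraicGeometry.Resolution.QuadraticTransformWeakTransform
import Mathlib.RingTheory.Valuation.LocalSubring
import HarnessLib

/-!
# Route `RadicialJung`, crux `CleanModels` (stmt-15917): the local rings of the blow-up of a
# closed point are quadratic transforms of the local ring of the centre (T2 brick B5-a, the
# scheme → chart bridge)

Support file (OURS) for PROGRAMME-clean-dim2 / T2 (`HOME/L/res-L0-w81-pv-2/g5/T2Skeleton.lean` v2,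
architecture `T2-ARCHITECTURE.md` §B5 "SCHEME PACKAGING of 2.3 … via `IsBlowup.exists_reesChart_stalk`
↔ quadratic transforms"), line `via-clean-models` of crux `DescentPerfectToAll` (stmt-0549).
Nothing here is a statement of Hironaka's manuscript.

The remaining stub `stub_lemma23` of the skeleton (Giraud's Lemme 2.3 at the points `ξ₁` of the
blow-up `π : X₁ → X` of ONE closed point `ξ` lying over `ξ`) is proved chart by chart in the
language of the tree's quadratic-transform files: everything inside the function field
`K = K(X)`, `R ≤ T` subrings of `K`, `T` a localisation of the chart `R[y/x]`
(`RadicialJungCleanModelsLogContentIdealBlowup.lean` for the ideals,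
`RadicialJungCleanModelsGiraudPointBound.lean` / `…GiraudCaseAB.lean` for the lengths). This file is
the dictionary from the scheme to that language, WITHOUT any valuation in the statement:

* `isQuadraticTransform_range_stalkEmb` — for a blowing up `π : X₁ → X` along `J` of an integral
  locally Noetherian scheme and `x′ ∈ X₁` with `J_{π x′} = 𝔪_{π x′}` (e.g. the blow-up of the
  closed point `π x′`): inside `K(X)`, the image `T` of `𝒪_{X₁,x′}` under the canonical embedding
  `ε_{x′}` (`IsBlowup.stalkEmb`) is a QUADRATIC TRANSFORM (`IsQuadraticTransform`) of the image
  `R` of `𝒪_{X,π x′}`. Proof: choose a valuation ring `O` of `K(X)` dominating the local subring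
  `T` (`LocalSubring.exists_le_valuationSubring`); then the valuative form
  `IsBlowup.isQuadraticTransformAlong_range_stalkEmb` (tree) applies, and a quadratic transform
  along `O` is a quadratic transform (`IsQuadraticTransformAlong.isQuadraticTransform`).
* `exists_ringEquiv_range_stalk`, `exists_ringEquiv_range_stalkEmb`, `inclusion_range_comm` —
  the isomorphisms `𝒪_{X,π x′} ≅ R`, `𝒪_{X₁,x′} ≅ T` and their compatibility with `π^♯_{x′}` and
  the inclusion `R ≤ T` (so that ring-isomorphism-invariant data — Giraud's `c`, the number of
  branches, `RadicialJungCleanModelsT2GiraudInvariantsTransport.lean` — move across);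
* `isQuadraticTransform_range_stalkEmb_point` — the same for the blow-up of the reduced closed
  point `𝓘_{ξ}` (`J_ξ = 𝔪_ξ` by `stalkIdeal_vanishingIdeal_singleton`);
* `maximalIdeal_range_eq_span_pair`, `chartAdjoin_le_or`, `chartAdjoin_le_or_origin` (in the
  second chart the point is its origin: `u/v ∈ 𝔪_T`), `range_stalkEmb_eq_ofPrime_chartAdjoin`
  — the chart dichotomy for generators `(u, v)` of `𝔪_{π x′}`: `R[v/u] ≤ T` or `R[u/v] ≤ T`
  (`chartAdjoin`), and in the first case (`u ≠ 0`) `T = R[v/u]_Q`, `Q = 𝔪_T ∩ R[v/u]`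
  (`LocalSubring.ofPrime`, which carries Mathlib's `IsLocalization.AtPrime` instance — the
  format `[Algebra (chartAdjoin x y) T] [IsLocalization.AtPrime T Q]` of the length files).

## References
* The Stacks Project, Tag 0804. [StacksProject]
* S. D. Cutkosky, Counterexamples to local monomialization in positive characteristic (2014),
  §2.1–2.2. [Cutkosky2014]
* C. Huneke, I. Swanson, Integral Closure of Ideals, Rings, and Modules (2006), §14.2.
  [HunekeSwanson2006]
-/

noncomputable section

set_option linter.dupNamespace false -- mandated namespace of this single-conjunct summit

open CategoryTheory AlgebraicGeometry TopologicalSpace IsLocalRing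
open Literature.AlgebraicGeometry.Resolution

namespace Summit.ResolutionOfSingularities.ResolutionOfSingularities.Theorems.RadicialJung.CleanModels.T2

universe u

open Scheme.IdealSheafData

/-! ## Ranges of injective homomorphisms of local rings into a field -/

section Range

variable {A : Type u} [CommRing A] {K : Type u} [Field K] (ψ : A →+* K)

/-- The range of an injective ring homomorphism is isomorphic to the source, compatibly with the
values. [folklore] -/
theorem exists_ringEquiv_range (hψ : Function.Injective ψ) :
    ∃ e : A ≃+* ψ.range, ∀ a, ((e a : ψ.range) : K) = ψ a :=
  ⟨RingEquiv.ofBijective ψ.rangeRestrict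
    ⟨fun _ _ h => hψ (congrArg Subtype.val h), ψ.rangeRestrict_surjective⟩, fun _ => rfl⟩

/-- For an injective `ψ` from a local ring: `ψ a` is a non-unit of the (local) range iff `a` is a
non-unit. [folklore] -/
theorem mem_maximalIdeal_range_iff [IsLocalRing A] (hψ : Function.Injective ψ)
    [IsLocalRing ψ.range] (a : A) :
    (⟨ψ a, a, rfl⟩ : ψ.range) ∈ maximalIdeal ψ.range ↔ a ∈ maximalIdeal A := by
  obtain ⟨e, he⟩ := exists_ringEquiv_range ψ hψ
  have hea : e a = ⟨ψ a, a, rfl⟩ := Subtype.ext (he a)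
  rw [← hea, IsLocalRing.mem_maximalIdeal, IsLocalRing.mem_maximalIdeal, mem_nonunits_iff,
    mem_nonunits_iff]
  exact (isUnit_map_iff e a).not

end Range

/-! ## The local rings of a point blow-up are quadratic transforms -/

section Blowup

variable {X₁ X : Scheme.{u}} [IsIntegral X] [IsLocallyNoetherian X] {π : X₁ ⟶ X}
  {J : X.IdealSheafData}

omit [IsLocallyNoetherian X] in
/-- The image of `𝒪_{X,s}` in `K(X)` is a local subring. [folklore] -/
theorem isLocalRing_range_algebraMap_stalk (s : X) :
    IsLocalRing (algebraMap (X.presheaf.stalk s) X.functionField).range :=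
  isLocalRing_of_range_eq _ _ rfl

/-- The image of `𝒪_{X₁,x′}` in `K(X)` under `ε_{x′}` is a local subring. [folklore] -/
theorem isLocalRing_range_stalkEmb (hπ : IsBlowup π J) (x' : X₁) :
    IsLocalRing (hπ.stalkEmb x').range :=
  isLocalRing_of_range_eq _ _ rfl

omit [IsLocallyNoetherian X] in
/-- `𝒪_{X,π x′} ≅ R := im(𝒪_{X,π x′} → K(X))`, compatibly with the values. [folklore] -/
theorem exists_ringEquiv_range_stalk (x' : X₁) :
    ∃ e : X.presheaf.stalk (π x') ≃+*
        (algebraMap (X.presheaf.stalk (π x')) X.functionField).range,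
      ∀ a, ((e a : (algebraMap (X.presheaf.stalk (π x')) X.functionField).range) :
          X.functionField) = algebraMap (X.presheaf.stalk (π x')) X.functionField a :=
  exists_ringEquiv_range _ (IsFractionRing.injective _ _)

/-- `𝒪_{X₁,x′} ≅ T := im(ε_{x′})`, compatibly with the values. [folklore] -/
theorem exists_ringEquiv_range_stalkEmb (hπ : IsBlowup π J) (x' : X₁) :
    ∃ e : X₁.presheaf.stalk x' ≃+* (hπ.stalkEmb x').range,
      ∀ a, ((e a : (hπ.stalkEmb x').range) : X.functionField) = hπ.stalkEmb x' a :=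
  exists_ringEquiv_range _ (hπ.stalkEmb_injective x')

/-- `R ≤ T`: the image of `𝒪_{X,π x′}` lies in the image of `𝒪_{X₁,x′}` (`ε_{x′} ∘ π^♯ = ` the
embedding of `𝒪_{X,π x′}`). [folklore] -/
theorem range_algebraMap_le_range_stalkEmb (hπ : IsBlowup π J) (x' : X₁) :
    (algebraMap (X.presheaf.stalk (π x')) X.functionField).range ≤ (hπ.stalkEmb x').range := by
  rintro _ ⟨a, rfl⟩
  exact ⟨(π.stalkMap x').hom a, hπ.stalkEmb_stalkMap x' a⟩

/-- The inclusion `R ≤ T` is `π^♯_{x′}` read in `K(X)`: `ε_{x′}(π^♯ a) = a`. [folklore] -/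
theorem inclusion_range_comm (hπ : IsBlowup π J) (x' : X₁) (a : X.presheaf.stalk (π x')) :
    (Subring.inclusion (range_algebraMap_le_range_stalkEmb hπ x')
        ⟨algebraMap (X.presheaf.stalk (π x')) X.functionField a, a, rfl⟩ : (hπ.stalkEmb x').range) =
      ⟨hπ.stalkEmb x' ((π.stalkMap x').hom a), (π.stalkMap x').hom a, rfl⟩ :=
  Subtype.ext (hπ.stalkEmb_stalkMap x' a).symm

/-- **The local ring of a point of the blow-up of a closed point is a quadratic transform of the
local ring of the centre** (inside `K(X)`): for `π : X₁ → X` a blowing up along `J` with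
`J_{π x′} = 𝔪_{π x′}`, `T = im ε_{x′}` is a quadratic transform of `R = im(𝒪_{X,π x′})`.
[cite: StacksProject, Tag 0804] [cite: Cutkosky2014, §2.1] -/
theorem isQuadraticTransform_range_stalkEmb (hπ : IsBlowup π J) (x' : X₁)
    (hJ : stalkIdeal J (π x') = maximalIdeal (X.presheaf.stalk (π x'))) :
    IsQuadraticTransform (algebraMap (X.presheaf.stalk (π x')) X.functionField).range
      (hπ.stalkEmb x').range := by
  set θ := algebraMap (X.presheaf.stalk (π x')) X.functionField with hθ
  set ε := hπ.stalkEmb x' with hε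
  haveI hRloc : IsLocalRing θ.range := isLocalRing_of_range_eq θ _ rfl
  haveI hTloc : IsLocalRing ε.range := isLocalRing_of_range_eq ε _ rfl
  -- a valuation ring `O` of `K(X)` dominating `T`
  obtain ⟨O, hO⟩ := (LocalSubring.mk ε.range).exists_le_valuationSubring
  rw [LocalSubring.le_def] at hO
  obtain ⟨hTO, hlocTO⟩ := hO
  have hTO' : ε.range ≤ O.toSubring := hTO
  have hmemO : ∀ r, (RingHom.id X.functionField) (ε r) ∈ O := fun r => hTO' ⟨r, rfl⟩
  -- `O` dominates `𝒪_{X₁,x′}` through `ε`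
  have hunitO : ∀ t : ε.range, IsUnit (Subring.inclusion hTO' t) → IsUnit t :=
    fun t ht => hlocTO.map_nonunit t ht
  have hdom : ∀ r, r ∈ maximalIdeal (X₁.presheaf.stalk x') →
      O.valuation ((RingHom.id X.functionField) (ε r)) < 1 := by
    intro r hr
    rw [RingHom.id_apply]
    have h1 : (⟨ε r, r, rfl⟩ : ε.range) ∈ maximalIdeal ε.range :=
      (mem_maximalIdeal_range_iff ε (hπ.stalkEmb_injective x') r).mpr hr
    have h2 : (⟨ε r, hTO' ⟨r, rfl⟩⟩ : O) ∈ maximalIdeal O := by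
      rw [IsLocalRing.mem_maximalIdeal, mem_nonunits_iff]
      intro hu
      exact (IsLocalRing.mem_maximalIdeal _ |>.mp h1) (hunitO _ hu)
    exact (O.valuation_lt_one_iff _).mp h2
  have key := hπ.isQuadraticTransformAlong_range_stalkEmb O x' hJ (RingHom.id X.functionField)
    hmemO hdom
  rw [RingHom.id_comp, RingHom.id_comp] at key
  -- `O` dominates `R` as well (`π^♯` and `T → O` are local)
  have hRO : θ.range ≤ O.toSubring := (range_algebraMap_le_range_stalkEmb hπ x').trans hTO'
  refine key.isQuadraticTransform ((subringDominates_valuationSubring_iff hRO).mpr fun a => ?_)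
  obtain ⟨_, r, rfl⟩ := a
  rw [mem_maximalIdeal_range_iff θ (IsFractionRing.injective _ _) r]
  constructor
  · intro hr
    have hr' : (π.stalkMap x').hom r ∈ maximalIdeal (X₁.presheaf.stalk x') := by
      rw [IsLocalRing.mem_maximalIdeal, mem_nonunits_iff]
      intro hu
      exact (IsLocalRing.mem_maximalIdeal _ |>.mp hr) (isUnit_of_map_unit (π.stalkMap x').hom r hu)
    have h := hdom ((π.stalkMap x').hom r) hr'
    rwa [RingHom.id_apply, hπ.stalkEmb_stalkMap x' r] at h
  · intro hv
    rw [IsLocalRing.mem_maximalIdeal, mem_nonunits_iff]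
    intro hu
    have h1 : IsUnit (⟨θ r, hRO ⟨r, rfl⟩⟩ : O) := by
      have h := hu.map ((Subring.inclusion hRO).comp θ.rangeRestrict)
      exact h
    exact (IsLocalRing.mem_maximalIdeal _ |>.mp ((O.valuation_lt_one_iff _).mpr hv)) h1

/-- **The blow-up of a closed point**: for `π` a blowing up along the reduced point `𝓘_{ξ}` and
`x′` over `ξ`, `T = im ε_{x′}` is a quadratic transform of `R = im(𝒪_{X,ξ})`.
[cite: StacksProject, Tag 0804] [cite: Cutkosky2014, §2.1] -/
theorem isQuadraticTransform_range_stalkEmb_point {ξ : X} (hξ : IsClosed ({ξ} : Set X))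
    (hπ : IsBlowup π (vanishingIdeal ⟨{ξ}, hξ⟩)) (x' : X₁) (hx' : π x' = ξ) :
    IsQuadraticTransform (algebraMap (X.presheaf.stalk (π x')) X.functionField).range
      (hπ.stalkEmb x').range := by
  subst hx'
  exact isQuadraticTransform_range_stalkEmb hπ x' (stalkIdeal_vanishingIdeal_singleton hξ)

/-! ## The two charts of a regular system of parameters `(u, v)` -/

omit [IsLocallyNoetherian X] in
/-- The maximal ideal of `R = im(𝒪_{X,π x′})` is generated by the images of generators of
`𝔪_{π x′}`. [folklore] -/
theorem maximalIdeal_range_eq_span_pair (x' : X₁) (u v : X.presheaf.stalk (π x'))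
    (huv : maximalIdeal (X.presheaf.stalk (π x')) = Ideal.span {u, v}) :
    haveI := isLocalRing_range_algebraMap_stalk (X := X) (π x')
    maximalIdeal (algebraMap (X.presheaf.stalk (π x')) X.functionField).range =
      Ideal.span {⟨algebraMap _ X.functionField u, u, rfl⟩, ⟨algebraMap _ X.functionField v, v, rfl⟩} := by
  haveI := isLocalRing_range_algebraMap_stalk (X := X) (π x')
  obtain ⟨e, he⟩ := exists_ringEquiv_range_stalk (X := X) (π := π) x'
  have heu : e u = ⟨algebraMap _ X.functionField u, u, rfl⟩ := Subtype.ext (he u)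
  have hev : e v = ⟨algebraMap _ X.functionField v, v, rfl⟩ := Subtype.ext (he v)
  rw [← map_ringEquiv_maximalIdeal e, huv, Ideal.map_span, Set.image_pair, heu, hev]

/-- **Chart dichotomy**: with `𝔪_{π x′} = (u, v)`, the quadratic transform `T = im ε_{x′}`
contains the chart `R[v/u]` or the chart `R[u/v]` (`IsQuadraticTransform.blowupRing_le_or`,
`blowupRing_eq_adjoin`). [cite: HunekeSwanson2006, §14.2 (p. 264)] -/
theorem chartAdjoin_le_or (hπ : IsBlowup π J) (x' : X₁)
    (hJ : stalkIdeal J (π x') = maximalIdeal (X.presheaf.stalk (π x')))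
    (u v : X.presheaf.stalk (π x')) (huv : maximalIdeal (X.presheaf.stalk (π x')) = Ideal.span {u, v}) :
    haveI := isLocalRing_range_algebraMap_stalk (X := X) (π x')
    chartAdjoin (K := X.functionField)
        (⟨algebraMap _ X.functionField u, u, rfl⟩ :
          (algebraMap (X.presheaf.stalk (π x')) X.functionField).range)
        ⟨algebraMap _ X.functionField v, v, rfl⟩ ≤ (hπ.stalkEmb x').range ∨
      chartAdjoin (K := X.functionField)
        (⟨algebraMap _ X.functionField v, v, rfl⟩ :
          (algebraMap (X.presheaf.stalk (π x')) X.functionField).range)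
        ⟨algebraMap _ X.functionField u, u, rfl⟩ ≤ (hπ.stalkEmb x').range := by
  haveI := isLocalRing_range_algebraMap_stalk (X := X) (π x')
  have hm := maximalIdeal_range_eq_span_pair (X := X) (π := π) x' u v huv
  have hm' : maximalIdeal (algebraMap (X.presheaf.stalk (π x')) X.functionField).range =
      Ideal.span {⟨algebraMap _ X.functionField v, v, rfl⟩, ⟨algebraMap _ X.functionField u, u, rfl⟩} := by
    rw [hm, Ideal.span_insert, Ideal.span_insert, sup_comm]
  rcases (isQuadraticTransform_range_stalkEmb hπ x' hJ).blowupRing_le_or hm with h | h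
  · left; rwa [blowupRing_eq_adjoin hm] at h
  · right; rwa [blowupRing_eq_adjoin hm'] at h

/-- **Refined chart dichotomy**: either the chart `R[v/u]` lies in `T`, or the chart `R[u/v]`
does AND `u/v` is a NON-unit of `T` — i.e. the point is the origin of the `v`-chart, the one
point of the exceptional curve not in the `u`-chart. [cite: HunekeSwanson2006, §14.2 (p. 264)] -/
theorem chartAdjoin_le_or_origin (hπ : IsBlowup π J) (x' : X₁)
    (hJ : stalkIdeal J (π x') = maximalIdeal (X.presheaf.stalk (π x')))
    (u v : X.presheaf.stalk (π x')) (huv : maximalIdeal (X.presheaf.stalk (π x')) = Ideal.span {u, v}) :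
    haveI := isLocalRing_range_algebraMap_stalk (X := X) (π x')
    haveI := isLocalRing_range_stalkEmb hπ x'
    chartAdjoin (K := X.functionField)
        (⟨algebraMap _ X.functionField u, u, rfl⟩ :
          (algebraMap (X.presheaf.stalk (π x')) X.functionField).range)
        ⟨algebraMap _ X.functionField v, v, rfl⟩ ≤ (hπ.stalkEmb x').range ∨
      (chartAdjoin (K := X.functionField)
          (⟨algebraMap _ X.functionField v, v, rfl⟩ :
            (algebraMap (X.presheaf.stalk (π x')) X.functionField).range)
          ⟨algebraMap _ X.functionField u, u, rfl⟩ ≤ (hπ.stalkEmb x').range ∧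
        ∃ h : algebraMap _ X.functionField u / algebraMap _ X.functionField v ∈ (hπ.stalkEmb x').range,
          (⟨_, h⟩ : (hπ.stalkEmb x').range) ∈ maximalIdeal (hπ.stalkEmb x').range) := by
  haveI := isLocalRing_range_algebraMap_stalk (X := X) (π x')
  haveI := isLocalRing_range_stalkEmb hπ x'
  by_cases h : chartAdjoin (K := X.functionField)
      (⟨algebraMap _ X.functionField u, u, rfl⟩ :
        (algebraMap (X.presheaf.stalk (π x')) X.functionField).range)
      ⟨algebraMap _ X.functionField v, v, rfl⟩ ≤ (hπ.stalkEmb x').range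
  · exact Or.inl h
  · right
    have hm := maximalIdeal_range_eq_span_pair (X := X) (π := π) x' u v huv
    have hm' : maximalIdeal (algebraMap (X.presheaf.stalk (π x')) X.functionField).range =
        Ideal.span {⟨algebraMap _ X.functionField v, v, rfl⟩,
          ⟨algebraMap _ X.functionField u, u, rfl⟩} := by
      rw [hm, Ideal.span_insert, Ideal.span_insert, sup_comm]
    have h2 := (chartAdjoin_le_or hπ x' hJ u v huv).resolve_left h
    have huv_mem : algebraMap _ X.functionField u / algebraMap _ X.functionField v ∈
        (hπ.stalkEmb x').range :=
      h2 (Algebra.subset_adjoin (Set.mem_singleton _))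
    refine ⟨h2, huv_mem, ?_⟩
    rw [mem_maximalIdeal_iff_inv_not_mem]
    by_cases h0 : algebraMap _ X.functionField u / algebraMap _ X.functionField v = 0
    · exact Or.inl h0
    · right
      intro hinv
      apply h
      have hv0 : algebraMap (X.presheaf.stalk (π x')) X.functionField v ≠ 0 := by
        intro hv
        apply h0
        rw [hv, div_zero]
      have h3 : blowupRing (algebraMap (X.presheaf.stalk (π x')) X.functionField).range
          (((⟨algebraMap _ X.functionField v, v, rfl⟩ :
            (algebraMap (X.presheaf.stalk (π x')) X.functionField).range) : X.functionField)) ≤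
          (hπ.stalkEmb x').range := by
        rw [blowupRing_eq_adjoin hm']; exact h2
      have hinv' : algebraMap (X.presheaf.stalk (π x')) X.functionField v /
          algebraMap _ X.functionField u ∈ (hπ.stalkEmb x').range := by
        rw [← inv_div]; exact hinv
      have h4 := blowupRing_le_of_div_mem hv0 h3 hinv'
      rw [blowupRing_eq_adjoin hm] at h4
      exact h4

/-- **In its chart the local ring IS the localised chart**: if `R[v/u] ≤ T` then
`T = R[v/u]_Q` with `Q = 𝔪_T ∩ R[v/u]` as subrings of `K(X)` (`LocalSubring.ofPrime`, which
carries the `IsLocalization.AtPrime` instance). [cite: HunekeSwanson2006, §14.2 (p. 264)] -/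
theorem range_stalkEmb_eq_ofPrime_chartAdjoin (hπ : IsBlowup π J) (x' : X₁)
    (hJ : stalkIdeal J (π x') = maximalIdeal (X.presheaf.stalk (π x')))
    (u v : X.presheaf.stalk (π x')) (huv : maximalIdeal (X.presheaf.stalk (π x')) = Ideal.span {u, v})
    (hu0 : u ≠ 0)
    (hle : haveI := isLocalRing_range_algebraMap_stalk (X := X) (π x')
      chartAdjoin (K := X.functionField)
        (⟨algebraMap _ X.functionField u, u, rfl⟩ :
          (algebraMap (X.presheaf.stalk (π x')) X.functionField).range)
        ⟨algebraMap _ X.functionField v, v, rfl⟩ ≤ (hπ.stalkEmb x').range) :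
    haveI := isLocalRing_range_algebraMap_stalk (X := X) (π x')
    haveI := isLocalRing_range_stalkEmb hπ x'
    (hπ.stalkEmb x').range =
      (LocalSubring.ofPrime
        (chartAdjoin (K := X.functionField)
          (⟨algebraMap _ X.functionField u, u, rfl⟩ :
            (algebraMap (X.presheaf.stalk (π x')) X.functionField).range)
          ⟨algebraMap _ X.functionField v, v, rfl⟩)
        ((maximalIdeal (hπ.stalkEmb x').range).comap (Subring.inclusion hle))).toSubring := by
  haveI := isLocalRing_range_algebraMap_stalk (X := X) (π x')
  haveI := isLocalRing_range_stalkEmb hπ x'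
  have hm := maximalIdeal_range_eq_span_pair (X := X) (π := π) x' u v huv
  have hq := isQuadraticTransform_range_stalkEmb hπ x' hJ
  have hu0' : (⟨algebraMap _ X.functionField u, u, rfl⟩ :
      (algebraMap (X.presheaf.stalk (π x')) X.functionField).range) ≠ 0 := by
    intro h
    have h' := congrArg Subtype.val h
    exact hu0 ((map_eq_zero_iff _ (IsFractionRing.injective _ _)).mp h')
  have humem : (⟨algebraMap _ X.functionField u, u, rfl⟩ :
      (algebraMap (X.presheaf.stalk (π x')) X.functionField).range) ∈
      maximalIdeal (algebraMap (X.presheaf.stalk (π x')) X.functionField).range :=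
    hm ▸ Ideal.subset_span (by simp)
  have hA : blowupRing (algebraMap (X.presheaf.stalk (π x')) X.functionField).range
      (((⟨algebraMap _ X.functionField u, u, rfl⟩ :
        (algebraMap (X.presheaf.stalk (π x')) X.functionField).range) : X.functionField)) ≤
      chartAdjoin (K := X.functionField)
        (⟨algebraMap _ X.functionField u, u, rfl⟩ :
          (algebraMap (X.presheaf.stalk (π x')) X.functionField).range)
        ⟨algebraMap _ X.functionField v, v, rfl⟩ :=
    (blowupRing_eq_adjoin hm).le
  exact hq.eq_ofPrime_of_le humem hu0' hA hle

end Blowup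

end Summit.ResolutionOfSingularities.ResolutionOfSingularities.Theorems.RadicialJung.CleanModels.T2

end
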